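import Summits.Ventures.CertifiedManyBodySolver.Certificates.SymRungV0core.Defs
import Summits.Ventures.CertifiedManyBodySolver.Theorems.M3x2EdgeSplitSymReplayBoxCanonAll

/-!
# Rung V = v0′ — R-block side conditions in box form, ONE Boolean fact (`gramBlockROKB` over all 85 blocks) + the 6-line transfer
lemma `gramR_all_of_allB` (hub-lb-sym-plan-1 g3; LANDED by hub-lb-sym-eng-3 as `Theorems…BoxCanonAll`, imported), giving `hRok` of the closing.  One `native_decide`
(one decode of the certificate + 85 box block checks; the per-fact form would re-decode 85 times — pen FINDING «PER-FACT RE-EVALUATION»).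
No bound of record moves; computational grade; no summit or crux statement is proved here; nothing here predicts superconductivity.
-/

namespace Summit.Ventures.CertifiedManyBodySolver.Certificates.SymRungV0core

open Summit.Ventures.CertifiedManyBodySolver.Theorems.SymReplay

/-- All 85 R-blocks pass their side conditions in box form (one compiled evaluation). -/
theorem hall : cert.gramR.all (gramBlockROKB lo hi) = true := by native_decide

/-- **All R-blocks pass** (`hRok` of the closing). -/
theorem hRok : cert.gramR.all (gramBlockROK cert.frame) = true := gramR_all_of_allB cert hbox hall

end Summit.Ventures.CertifiedManyBodySolver.Certificates.SymRungV0core
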